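import Mathlib
import Literature.NumberTheory.LFunctions.Zhang2022.Section8Ded81Prelims
import HarnessLib

/-!
# Zhang (2022) §8, proof of Lemma 8.1 (Z22:Lem8.1.pf, pp. 42–44, tex L2193–2265): the kernel EDGE
# «(8.1) + the three estimates of p. 44 + the contour shift ⇒ Lemma 8.1», hence the leaf `Ded81 c′`

Topic `Literature/NumberTheory/LFunctions/Zhang2022` (Landau–Siegel adjudication tree;
verdict-neutral). Y. Zhang, *Discrete mean estimates and the Landau–Siegel zero*,
arXiv:2211.02515v1 (2022) [Zhang2022LandauSiegel] — **an unrefereed manuscript under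
adjudication; every hypothesis below is a displayed CLAIM of the manuscript, taken as a
hypothesis, NOT asserted.** Cell siegel-zhang (D-0069), discharge node **D21 / cone C19 =
`Skeleton.Ded81 c′`** (DAG `Z22:Lem8.1.pf`).

The manuscript's proof of Lemma 8.1 (pp. 42–44) runs: for `ψ ∈ Ψ₁`, (8.1)
`Σ_{ρ∈𝔷(ψ)}𝔠*A(a₁;ρ)A(a₂;1−ρ)ω(ρ) = Ĩ₁⁺ − Ĩ₁⁻ + O(ε)` (Prop. 2.2, Lemma 5.9, residue theorem);
the reflection `−Ĩ₁⁻(a₁,a₂;ψ) = conj Ĩ₁⁺(ā₂,ā₁;ψ)` ((2.11) and analytic continuation); `Ĩ₁⁺ − I₁⁺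
≪ 𝓛⁻¹¹⁴∫_{𝔍(α)}|L(s+β₂)L(s+β₃)A A ω|` (Lemmas 5.2, 5.9); the two mean squares `≪ P²𝓛³⁶` over `Ψ₁`
(Cauchy, Lemma 6.1, Lemma 3.3); hence `Σ_{Ψ₁}(Ĩ₁⁺ − I₁⁺) = o(𝔓)` by (7.4), (2.9); the shift
`Σ_{Ψ₁}I₁⁺ = Θ₁ + O(ε)`; "a similar result" for the conjugate term. This file PROVES the
implication from the five displayed analytic steps (typed at the skeleton's objects: `Ĩ₁^±` =
`Lemma81.Itilde` of `Section8Reflection` at `z = ±α`, `I₁⁺` = `Lemma81.segInt` at `z = α` of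
`𝔠·A·A·ω`, i.e. the integrand of `Skeleton.Theta1`) to the node `Skeleton.Lemma81 c′`, kernel-checking
everything in between: the reflection (tree `Lemma81.neg_Itilde_neg_eq_conj`, whose side conditions
`b_j ≥ 0`, `|𝓛₁| < 2πt₀` hold for large `D`), the interchange-and-dominate step Z22:§8.u014
(`sum_norm_Itilde_sub_I_le`: `2|LL||AA| ≤ |LL|² + |AA|²`, `Σ_ψ∫ = ∫Σ_ψ`, (7.4) in the tree's
proved form), "a similar result holds" for `(ā₂,ā₁)` (which satisfy (7.2) with the same bound),
`#Ψ₁ ≤ 𝔓` for the summed `O(ε)`, (2.9) for `P²𝓛⁻⁷⁸ = o(𝔓)`, and the `ε`-assembly.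

* `sum_norm_Itilde_sub_I_le` — Z22:§8.u015 from §8.u012–u014 (quantitative);
* `Skeleton.lemma81_of_steps` — **the edge**: (8.1) ∧ u012 ∧ u013 ∧ u014 ∧ u016 ⇒ `Lemma81 c′`;
* `Skeleton.ded81_of_lemma81` — `Lemma81 c′ → Ded81 c′` (the leaf's cited inputs Prop. 2.2,
  Lemmas 3.3, 5.2, 5.9, 6.1 enter only through the five steps).

DAG join (plan/L2 row 6, `Section8aStatements` of L2-t7, p412578): hypotheses are the bodies of
`Eq81 c′` ↔ Z22:(8.1), `Step8u012 c′` ↔ Z22:§8.u012, `Step8u013 c′` ↔ §8.u013, `Step8u014 c′` ↔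
§8.u014, `Step8u016 c′` ↔ §8.u016 (with `Itil`/`IonePlus`/`onJ` unfolded; `Itil = Lemma81.Itilde` by
their `Itil_eq_Itilde`); proved here: §8.u009/u010 (reflection, via tree), §8.u015, §8.u017 and the
final assembly, plus the implicit count `CardPsiOneLe` (`Ded81Edge.card_finsetOf_psiOne_le_frakP`). No definitions, no new named facts.
WHAT THIS IS NOT: a proof of (8.1) or of the three estimates, or any claim about Theorems 1–2 of
the source or Landau–Siegel zeros.

## References

* Y. Zhang, arXiv:2211.02515v1 (2022), §8 Lemma 8.1 and its proof, pp. 42–44; (7.4); (2.9).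
  [cite: Zhang2022LandauSiegel, §8 Lemma 8.1 pp.42–44]
-/

noncomputable section

open Complex Real ComplexConjugate MeasureTheory Set Filter

namespace Literature.NumberTheory.LFunctions.Zhang2022.Ded81Edge

open Skeleton

/-! ## §6. "`Σ_{ψ∈Ψ₁} (Ĩ₁⁺ − I₁⁺) = o(𝔓)`" from the three estimates of p. 44 and (7.4) -/

/-- `2xy ≤ x² + y²`, the form of "Cauchy's inequality" that suffices pointwise in §8 p. 44. [folklore] -/
private theorem two_mul_le_sq_add_sq (x y : ℝ) : 2 * (x * y) ≤ x ^ 2 + y ^ 2 := by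
  nlinarith [sq_nonneg (x - y)]

/-- **Z22:§8.u015** ("These estimates together with (7.4) and (2.9) imply
`Σ_{ψ∈Ψ₁}(Ĩ₁⁺(a₁,a₂;ψ) − I₁⁺(a₁,a₂;ψ)) = o(𝔓)`", §8 p. 44), quantitative kernel form: from
(u012) `|Ĩ₁⁺ − I₁⁺| ≤ C₂𝓛⁻¹¹⁴∫_{𝔍(α)}|L(s+β₂,ψ)L(s+β₃,ψ)A(a₁;s,ψ)A(a₂;1−s,ψ̄)ω(s)||ds|` for each
`ψ ∈ Ψ₁`, (u013) `Σ_{ψ∈Ψ₁}|L(s+β₂,ψ)L(s+β₃,ψ)|² ≤ C₃P²𝓛³⁶` and (u014)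
`Σ_{ψ∈Ψ₁}|A(a₁;s,ψ)A(a₂;1−s,ψ̄)|² ≤ C₄P²𝓛³⁶` on `𝔍(α)`, one gets
`Σ_{ψ∈Ψ₁}|Ĩ₁⁺ − I₁⁺| ≤ C₂𝓛⁻¹¹⁴ · ½(C₃+C₄)P²𝓛³⁶ · 2πe^{1/4}` (pointwise `2|LL||AA| ≤ |LL|²+|AA|²`,
interchange of `Σ_ψ` and `∫`, and (7.4) in the tree's form
`SmoothWeight.integral_norm_omega_segment_le_of_abs_le`). Here `s = α + s₀ + iv` runs over `𝔍(α)`.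
[cite: Zhang2022LandauSiegel, §8 p. 44 (proof of Lemma 8.1)] -/
theorem sum_norm_Itilde_sub_I_le (c' : ℝ) {D : ℕ} [NeZero D] (χ : DirichletCharacter ℂ D)
    (a₁ a₂ : ℕ → ℂ) {C₂ C₃ C₄ : ℝ} (hC₂ : 0 ≤ C₂) (hC₃₄ : 0 ≤ C₃ + C₄) (hℓ₁ : 0 ≤ ell1 D)
    (hℓ₂ : 0 < ell2 D) (hαℓ : |alpha D| ≤ ell2 D)
    (hΔ : ∀ x ∈ finsetOf (PsiOne χ),
      ‖Lemma81.Itilde x.ψ (Yroot x.ψ) (b1 c' D) (b2 c' D) (b3 c' D) (Nsupp D) (ell2 D) (t0 D)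
            (ell1 D) ((alpha D : ℝ) : ℂ) a₁ a₂ -
          Lemma81.segInt (t0 D) (ell1 D) ((alpha D : ℝ) : ℂ) (fun s =>
            frakcW c' x s * Apoly x a₁ s * ApolyBar x a₂ (1 - s) * omegaW D s)‖ ≤
        C₂ * (ell D ^ 114)⁻¹ * ∫ v in (-ell1 D)..ell1 D,
          ‖x.ψ.LFunction (((alpha D : ℝ) : ℂ) + s0 D + v * I + beta2 c' D) *
              x.ψ.LFunction (((alpha D : ℝ) : ℂ) + s0 D + v * I + beta3 c' D) *
            Apoly x a₁ (((alpha D : ℝ) : ℂ) + s0 D + v * I) *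
              ApolyBar x a₂ (1 - (((alpha D : ℝ) : ℂ) + s0 D + v * I)) *
            omegaW D (((alpha D : ℝ) : ℂ) + s0 D + v * I)‖)
    (hL : ∀ v ∈ Icc (-ell1 D) (ell1 D),
      ∑ x ∈ finsetOf (PsiOne χ),
        ‖x.ψ.LFunction (((alpha D : ℝ) : ℂ) + s0 D + v * I + beta2 c' D) *
            x.ψ.LFunction (((alpha D : ℝ) : ℂ) + s0 D + v * I + beta3 c' D)‖ ^ 2 ≤
        C₃ * bigP D ^ 2 * ell D ^ 36)
    (hA : ∀ v ∈ Icc (-ell1 D) (ell1 D),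
      ∑ x ∈ finsetOf (PsiOne χ),
        ‖Apoly x a₁ (((alpha D : ℝ) : ℂ) + s0 D + v * I) *
            ApolyBar x a₂ (1 - (((alpha D : ℝ) : ℂ) + s0 D + v * I))‖ ^ 2 ≤
        C₄ * bigP D ^ 2 * ell D ^ 36) :
    ∑ x ∈ finsetOf (PsiOne χ),
      ‖Lemma81.Itilde x.ψ (Yroot x.ψ) (b1 c' D) (b2 c' D) (b3 c' D) (Nsupp D) (ell2 D) (t0 D)
            (ell1 D) ((alpha D : ℝ) : ℂ) a₁ a₂ -
          Lemma81.segInt (t0 D) (ell1 D) ((alpha D : ℝ) : ℂ) (fun s =>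
            frakcW c' x s * Apoly x a₁ s * ApolyBar x a₂ (1 - s) * omegaW D s)‖ ≤
      C₂ * (ell D ^ 114)⁻¹ *
        ((C₃ + C₄) / 2 * (bigP D ^ 2 * ell D ^ 36) * (2 * π * Real.exp (1 / 4))) := by
  -- the running point `s = α + s₀ + iv` of `𝔍(α)`
  set pt : ℝ → ℂ := fun v => ((alpha D : ℝ) : ℂ) + s0 D + v * I with hpt_def
  have hpt : Continuous pt := by rw [hpt_def]; fun_prop
  -- the dominating function `G(v) = ½(C₃+C₄)P²𝓛³⁶ |ω(s)|`
  set G : ℝ → ℝ := fun v => (C₃ + C₄) / 2 * (bigP D ^ 2 * ell D ^ 36) * ‖omegaW D (pt v)‖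
    with hG_def
  have hωc : Continuous fun v => omegaW D (pt v) := (continuous_omega _ _).comp hpt
  have hGc : Continuous G := continuous_const.mul hωc.norm
  have hc : 0 ≤ C₂ * (ell D ^ 114)⁻¹ :=
    mul_nonneg hC₂ (inv_nonneg.mpr ((by decide : Even 114).pow_nonneg _))
  have hX : 0 ≤ (C₃ + C₄) / 2 * (bigP D ^ 2 * ell D ^ 36) :=
    mul_nonneg (by linarith) (mul_nonneg (sq_nonneg _) ((by decide : Even 36).pow_nonneg _))
  -- continuity of the integrands `g_ψ(v) = |L(s+β₂,ψ)L(s+β₃,ψ)A(a₁;s,ψ)A(a₂;1−s,ψ̄)ω(s)|`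
  have hg : ∀ x ∈ finsetOf (PsiOne χ), Continuous fun v =>
      ‖x.ψ.LFunction (pt v + beta2 c' D) * x.ψ.LFunction (pt v + beta3 c' D) *
        Apoly x a₁ (pt v) * ApolyBar x a₂ (1 - pt v) * omegaW D (pt v)‖ := by
    intro x _
    refine Continuous.norm ?_
    have h2 : Continuous fun v => x.ψ.LFunction (pt v + beta2 c' D) :=
      (continuous_LFunction_chr x).comp (hpt.add continuous_const)
    have h3 : Continuous fun v => x.ψ.LFunction (pt v + beta3 c' D) :=
      (continuous_LFunction_chr x).comp (hpt.add continuous_const)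
    have hA1 : Continuous fun v => Apoly x a₁ (pt v) :=
      (continuous_dirPoly (Nsupp D) a₁ x.ψ x.p_ne_one).comp hpt
    have hA2 : Continuous fun v => ApolyBar x a₂ (1 - pt v) :=
      (continuous_dirPoly (Nsupp D) a₂ x.ψ⁻¹ x.p_ne_one).comp (continuous_const.sub hpt)
    exact (((h2.mul h3).mul hA1).mul hA2).mul hωc
  -- pointwise domination on the segment: `Σ_ψ |LL|·|AA|·|ω| ≤ ½(Σ|LL|² + Σ|AA|²)|ω| ≤ G`
  have hle : ∀ v ∈ Icc (-ell1 D) (ell1 D), ∑ x ∈ finsetOf (PsiOne χ),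
      ‖x.ψ.LFunction (pt v + beta2 c' D) * x.ψ.LFunction (pt v + beta3 c' D) *
        Apoly x a₁ (pt v) * ApolyBar x a₂ (1 - pt v) * omegaW D (pt v)‖ ≤ G v := by
    intro v hv
    have hLv := hL v hv
    have hAv := hA v hv
    have hterm : ∀ x ∈ finsetOf (PsiOne χ),
        ‖x.ψ.LFunction (pt v + beta2 c' D) * x.ψ.LFunction (pt v + beta3 c' D) *
          Apoly x a₁ (pt v) * ApolyBar x a₂ (1 - pt v) * omegaW D (pt v)‖ =
        (‖x.ψ.LFunction (pt v + beta2 c' D) * x.ψ.LFunction (pt v + beta3 c' D)‖ *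
          ‖Apoly x a₁ (pt v) * ApolyBar x a₂ (1 - pt v)‖) * ‖omegaW D (pt v)‖ := by
      intro x _
      simp only [norm_mul]
      ring
    rw [Finset.sum_congr rfl hterm, ← Finset.sum_mul]
    have h2 := Finset.sum_le_sum (s := finsetOf (PsiOne χ)) fun x _ => two_mul_le_sq_add_sq
      ‖x.ψ.LFunction (pt v + beta2 c' D) * x.ψ.LFunction (pt v + beta3 c' D)‖
      ‖Apoly x a₁ (pt v) * ApolyBar x a₂ (1 - pt v)‖
    rw [← Finset.mul_sum, Finset.sum_add_distrib] at h2
    have hsum : ∑ x ∈ finsetOf (PsiOne χ),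
        ‖x.ψ.LFunction (pt v + beta2 c' D) * x.ψ.LFunction (pt v + beta3 c' D)‖ *
          ‖Apoly x a₁ (pt v) * ApolyBar x a₂ (1 - pt v)‖ ≤
        (C₃ + C₄) / 2 * (bigP D ^ 2 * ell D ^ 36) := by
      linarith
    exact mul_le_mul_of_nonneg_right hsum (norm_nonneg _)
  -- the abstract interchange-and-dominate lemma
  have key := sum_le_mul_integral_of_pointwise (finsetOf (PsiOne χ))
    (fun x => ‖Lemma81.Itilde x.ψ (Yroot x.ψ) (b1 c' D) (b2 c' D) (b3 c' D) (Nsupp D) (ell2 D)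
        (t0 D) (ell1 D) ((alpha D : ℝ) : ℂ) a₁ a₂ -
      Lemma81.segInt (t0 D) (ell1 D) ((alpha D : ℝ) : ℂ) (fun s =>
        frakcW c' x s * Apoly x a₁ s * ApolyBar x a₂ (1 - s) * omegaW D s)‖)
    (fun x v => ‖x.ψ.LFunction (pt v + beta2 c' D) * x.ψ.LFunction (pt v + beta3 c' D) *
        Apoly x a₁ (pt v) * ApolyBar x a₂ (1 - pt v) * omegaW D (pt v)‖)
    G (by linarith : -ell1 D ≤ ell1 D) hc hΔ hg hGc hle
  -- (7.4): `∫_{𝔍(α)} |ω(s) ds| ≤ 2πe^{1/4}` (`|α| ≤ 𝓛₂`)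
  have h74 : ∫ v in (-ell1 D)..ell1 D, ‖omegaW D (pt v)‖ ≤ 2 * π * Real.exp (1 / 4) :=
    SmoothWeight.integral_norm_omega_segment_le_of_abs_le hℓ₂ (t0 D) hαℓ hℓ₁
  have hGint : ∫ v in (-ell1 D)..ell1 D, G v =
      (C₃ + C₄) / 2 * (bigP D ^ 2 * ell D ^ 36) * ∫ v in (-ell1 D)..ell1 D, ‖omegaW D (pt v)‖ :=
    intervalIntegral.integral_const_mul _ _
  refine key.trans ?_
  rw [hGint]
  exact mul_le_mul_of_nonneg_left (mul_le_mul_of_nonneg_left h74 hX) hc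

end Literature.NumberTheory.LFunctions.Zhang2022.Ded81Edge

namespace Literature.NumberTheory.LFunctions.Zhang2022.Skeleton

open Ded81Edge

/-! ## §7. The kernel edge: the typed proof steps of Z22:Lem8.1.pf ⇒ Lemma 8.1 -/

/-- **Lemma 8.1 from the displayed steps of its proof** (§8 pp. 42–44, Z22:Lem8.1.pf), the kernel
EDGE. Hypotheses, each a displayed CLAIM of the manuscript typed at the skeleton's objects
(`Ĩ₁^±(a₁,a₂;ψ)` = `Lemma81.Itilde` at `z = ±α` with `𝒞̃ = −iM(s+β₁)M(s+β₂)M(s+β₃)/M(s)`,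
`M = Y·L(·,ψ)`; `I₁⁺(a₁,a₂;ψ)` = `Lemma81.segInt` at `z = α` of `𝔠(s,ψ)A(a₁;s,ψ)A(a₂;1−s,ψ̄)ω(s)`;
`s = α + s₀ + iv` on `𝔍(α)`):
* `h81` — **(8.1)** (Z22:(8.1), "By Lemma 5.9, the residue theorem and a simple bound for `ω(s)`"):
  for `ψ ∈ Ψ₁`, `Σ_{ρ∈𝔷(ψ)} 𝔠*(ρ,ψ)A(a₁;ρ,ψ)A(a₂;1−ρ,ψ̄)ω(ρ) = Ĩ₁⁺ − Ĩ₁⁻ + O(ε)`, `ε = exp{−c𝓛¹⁰}`;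
* `hΔ` — Z22:§8.u012 ("By Lemma 5.2 and 5.9"):
  `Ĩ₁⁺ − I₁⁺ ≪ 𝓛⁻¹¹⁴∫_{𝔍(α)}|L(s+β₂,ψ)L(s+β₃,ψ)A(a₁;s,ψ)A(a₂;1−s,ψ̄)ω(s)ds|`;
* `hL` — Z22:§8.u013 ("By Cauchy's inequality, Lemma 6.1, and the second assertion of Lemma 3.3"):
  `Σ_{ψ∈Ψ₁}|L(s+β₂,ψ)L(s+β₃,ψ)|² ≪ P²𝓛³⁶` for `s ∈ 𝔍(α)`;
* `hA` — Z22:§8.u014: `Σ_{ψ∈Ψ₁}|A(a₁;s,ψ)A(a₂;1−s,ψ̄)|² ≪ P²𝓛³⁶` for `s ∈ 𝔍(α)`;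
* `hshift` — Z22:§8.u016 ("moving the segment `𝔍(α)` to `𝔍(1)` gives
  `Σ_{ψ∈Ψ₁}I₁⁺(a₁,a₂;ψ) = Θ₁(a₁,a₂) + O(ε)`").
PROVED here from these: the reflection `−Ĩ₁⁻(a₁,a₂;ψ) = conj Ĩ₁⁺(ā₂,ā₁;ψ)` (Z22:§8.u005–u009, tree
`Section8Reflection`), the interchange-and-dominate step Z22:§8.u015 (`sum_norm_Itilde_sub_I_le`,
with (7.4)), "a similar result holds for `conj Ĩ₁⁺(ā₂,ā₁;ψ)`" (Z22:§8.u017, via `ā` admissible),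
the count `#Ψ₁ ≤ 𝔓` for the summed `O(ε)`, (2.9) for `P²𝓛⁻⁷⁸ = o(𝔓)`, and the final assembly
Z22:§8.u010/u017 — i.e. **Lemma 8.1** `Σ_{ψ∈Ψ₁}Σ_{ρ∈𝔷(ψ)}𝔠*A(a₁)A(a₂)ω = Θ₁(a₁,a₂) + conj Θ₁(ā₂,ā₁) + o(𝔓)`
(the skeleton node `Lemma81 c′`), for every real `c′`. Nothing here asserts the five hypotheses.
[cite: Zhang2022LandauSiegel, §8 Lemma 8.1, pp. 42–44] -/
theorem lemma81_of_steps (c' : ℝ)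
    (h81 : ∀ B : ℝ, ∃ c : ℝ, 0 < c ∧ ∃ C : ℝ, ForAllLarge fun D _ χ => AssumptionA D χ →
      ∀ a₁ a₂ : ℕ → ℂ, Adm72 D B a₁ → Adm72 D B a₂ → ∀ x ∈ PsiOne χ,
        ‖(∑ ρ ∈ finsetOf (zeroSet D x),
              cstar c' D x ρ * Apoly x a₁ ρ * ApolyBar x a₂ (1 - ρ) * omegaW D ρ) -
            (Lemma81.Itilde x.ψ (Yroot x.ψ) (b1 c' D) (b2 c' D) (b3 c' D) (Nsupp D) (ell2 D)
                (t0 D) (ell1 D) ((alpha D : ℝ) : ℂ) a₁ a₂ -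
              Lemma81.Itilde x.ψ (Yroot x.ψ) (b1 c' D) (b2 c' D) (b3 c' D) (Nsupp D) (ell2 D)
                (t0 D) (ell1 D) ((-alpha D : ℝ) : ℂ) a₁ a₂)‖ ≤
          C * Real.exp (-c * ell D ^ 10))
    (hΔ : ∀ B : ℝ, ∃ C : ℝ, ForAllLarge fun D _ χ => AssumptionA D χ →
      ∀ a₁ a₂ : ℕ → ℂ, Adm72 D B a₁ → Adm72 D B a₂ → ∀ x ∈ PsiOne χ,
        ‖Lemma81.Itilde x.ψ (Yroot x.ψ) (b1 c' D) (b2 c' D) (b3 c' D) (Nsupp D) (ell2 D) (t0 D)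
              (ell1 D) ((alpha D : ℝ) : ℂ) a₁ a₂ -
            Lemma81.segInt (t0 D) (ell1 D) ((alpha D : ℝ) : ℂ) (fun s =>
              frakcW c' x s * Apoly x a₁ s * ApolyBar x a₂ (1 - s) * omegaW D s)‖ ≤
          C * (ell D ^ 114)⁻¹ * ∫ v in (-ell1 D)..ell1 D,
            ‖x.ψ.LFunction (((alpha D : ℝ) : ℂ) + s0 D + v * I + beta2 c' D) *
                x.ψ.LFunction (((alpha D : ℝ) : ℂ) + s0 D + v * I + beta3 c' D) *
              Apoly x a₁ (((alpha D : ℝ) : ℂ) + s0 D + v * I) *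
                ApolyBar x a₂ (1 - (((alpha D : ℝ) : ℂ) + s0 D + v * I)) *
              omegaW D (((alpha D : ℝ) : ℂ) + s0 D + v * I)‖)
    (hL : ∃ C : ℝ, ForAllLarge fun D _ χ => AssumptionA D χ → ∀ s : ℂ,
      (∃ v : ℝ, |v| ≤ ell1 D ∧ s = ((alpha D : ℝ) : ℂ) + s0 D + v * I) →
        ∑ x ∈ finsetOf (PsiOne χ),
          ‖x.ψ.LFunction (s + beta2 c' D) * x.ψ.LFunction (s + beta3 c' D)‖ ^ 2 ≤
          C * bigP D ^ 2 * ell D ^ 36)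
    (hA : ∀ B : ℝ, ∃ C : ℝ, ForAllLarge fun D _ χ => AssumptionA D χ →
      ∀ a₁ a₂ : ℕ → ℂ, Adm72 D B a₁ → Adm72 D B a₂ → ∀ s : ℂ,
        (∃ v : ℝ, |v| ≤ ell1 D ∧ s = ((alpha D : ℝ) : ℂ) + s0 D + v * I) →
          ∑ x ∈ finsetOf (PsiOne χ), ‖Apoly x a₁ s * ApolyBar x a₂ (1 - s)‖ ^ 2 ≤
            C * bigP D ^ 2 * ell D ^ 36)
    (hshift : ∀ B : ℝ, ∃ c : ℝ, 0 < c ∧ ∃ C : ℝ, ForAllLarge fun D _ χ => AssumptionA D χ →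
      ∀ a₁ a₂ : ℕ → ℂ, Adm72 D B a₁ → Adm72 D B a₂ →
        ‖(∑ x ∈ finsetOf (PsiOne χ), Lemma81.segInt (t0 D) (ell1 D) ((alpha D : ℝ) : ℂ) (fun s =>
              frakcW c' x s * Apoly x a₁ s * ApolyBar x a₂ (1 - s) * omegaW D s)) -
            Theta1 c' χ a₁ a₂‖ ≤ C * Real.exp (-c * ell D ^ 10)) :
    Lemma81 c' := by
  intro B ε hε
  obtain ⟨c₁, hc₁, C₁, h81'⟩ := h81 B
  obtain ⟨C₂, hΔ'⟩ := hΔ B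
  obtain ⟨C₃, hL'⟩ := hL
  obtain ⟨C₄, hA'⟩ := hA B
  obtain ⟨c₅, hc₅, C₅, hshift'⟩ := hshift B
  -- the coefficient of the main error term `K·P²𝓛³⁶𝓛⁻¹¹⁴`
  set K : ℝ := max C₂ 0 * ((max C₃ 0 + max C₄ 0) / 2 * (2 * π * Real.exp (1 / 4))) with hK
  obtain ⟨D₁, hD₁⟩ := exists_params_large c'
  obtain ⟨D₂, hD₂⟩ := exists_large_main_le (2 * K) (ε / 2) (by linarith)
  obtain ⟨D₃, hD₃⟩ := exists_large_exp_le (max C₁ 0) c₁ (ε / 4) hc₁ (by linarith)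
  obtain ⟨D₄, hD₄⟩ := exists_large_exp_le (2 * max C₅ 0) c₅ (ε / 4) hc₅ (by linarith)
  obtain ⟨D₅, hD₅⟩ := exists_two_le_frakP
  obtain ⟨D₆, hD₆⟩ := ((h81'.and hΔ').and (hL'.and hA')).and hshift'
  refine ⟨max (max (max D₁ D₂) (max D₃ D₄)) (max D₅ D₆),
    fun D _ χ hD hq hp hAss a₁ a₂ ha₁ ha₂ => ?_⟩
  have hD1 := hD₁ D (le_trans (le_trans (le_trans (le_max_left _ _) (le_max_left _ _))
    (le_max_left _ _)) hD)
  have hD2 := hD₂ D (le_trans (le_trans (le_trans (le_max_right _ _) (le_max_left _ _))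
    (le_max_left _ _)) hD)
  have hD3 := hD₃ D (le_trans (le_trans (le_trans (le_max_left _ _) (le_max_right _ _))
    (le_max_left _ _)) hD)
  have hD4 := hD₄ D (le_trans (le_trans (le_trans (le_max_right _ _) (le_max_right _ _))
    (le_max_left _ _)) hD)
  have hD5 := hD₅ D (le_trans (le_trans (le_max_left _ _) (le_max_right _ _)) hD)
  obtain ⟨⟨⟨h81D, hΔD⟩, ⟨hLD, hAD⟩⟩, hshiftD⟩ :=
    hD₆ D χ (le_trans (le_trans (le_max_right _ _) (le_max_right _ _)) hD) hq hp
  obtain ⟨hL1, hb1, hb2, hb3, hℓt, hαℓ, hℓ₁, hℓ₂, hα0⟩ := hD1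
  have ha₁c := adm72_conj ha₁
  have ha₂c := adm72_conj ha₂
  -- the left side of Lemma 8.1 as `Σ_{ψ∈Ψ₁}` of the zero sums
  have hlhs : lhs81 c' χ a₁ a₂ = ∑ x ∈ finsetOf (PsiOne χ), ∑ ρ ∈ finsetOf (zeroSet D x),
      cstar c' D x ρ * Apoly x a₁ ρ * ApolyBar x a₂ (1 - ρ) * omegaW D ρ := by
    unfold lhs81 idx
    rw [Finset.sum_sigma]
  rw [hlhs]
  -- nonnegativity of the three error sizes
  have he₁ : 0 ≤ Real.exp (-c₁ * ell D ^ 10) := (Real.exp_pos _).le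
  have he₅ : 0 ≤ Real.exp (-c₅ * ell D ^ 10) := (Real.exp_pos _).le
  have hmem : ∀ v ∈ Icc (-ell1 D) (ell1 D),
      ∃ w : ℝ, |w| ≤ ell1 D ∧ ((alpha D : ℝ) : ℂ) + s0 D + v * I =
        ((alpha D : ℝ) : ℂ) + s0 D + w * I :=
    fun v hv => ⟨v, abs_le.mpr ⟨by linarith [hv.1], hv.2⟩, rfl⟩
  have hX : 0 ≤ bigP D ^ 2 * ell D ^ 36 :=
    mul_nonneg (sq_nonneg _) ((by decide : Even 36).pow_nonneg _)
  have h114 : 0 ≤ (ell D ^ 114)⁻¹ := inv_nonneg.mpr ((by decide : Even 114).pow_nonneg _)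
  -- the `ℓ¹` bound over `Ψ₁` for `Ĩ₁⁺ − I₁⁺`, for `(a₁,a₂)` and for `(ā₂,ā₁)`
  have hI : ∀ b₁ b₂ : ℕ → ℂ, Adm72 D B b₁ → Adm72 D B b₂ →
      ∑ x ∈ finsetOf (PsiOne χ),
        ‖Lemma81.Itilde x.ψ (Yroot x.ψ) (b1 c' D) (b2 c' D) (b3 c' D) (Nsupp D) (ell2 D) (t0 D)
              (ell1 D) ((alpha D : ℝ) : ℂ) b₁ b₂ -
            Lemma81.segInt (t0 D) (ell1 D) ((alpha D : ℝ) : ℂ) (fun s =>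
              frakcW c' x s * Apoly x b₁ s * ApolyBar x b₂ (1 - s) * omegaW D s)‖ ≤
        max C₂ 0 * (ell D ^ 114)⁻¹ *
          ((max C₃ 0 + max C₄ 0) / 2 * (bigP D ^ 2 * ell D ^ 36) * (2 * π * Real.exp (1 / 4))) := by
    intro b₁ b₂ hb₁ hb₂
    refine sum_norm_Itilde_sub_I_le c' χ b₁ b₂ (le_max_right _ _)
      (add_nonneg (le_max_right _ _) (le_max_right _ _)) hℓ₁ hℓ₂ hαℓ ?_ ?_ ?_
    · intro x hx
      refine (hΔD hAss b₁ b₂ hb₁ hb₂ x (mem_of_mem_finsetOf hx)).trans ?_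
      have hint : 0 ≤ ∫ v in (-ell1 D)..ell1 D,
          ‖x.ψ.LFunction (((alpha D : ℝ) : ℂ) + s0 D + v * I + beta2 c' D) *
              x.ψ.LFunction (((alpha D : ℝ) : ℂ) + s0 D + v * I + beta3 c' D) *
            Apoly x b₁ (((alpha D : ℝ) : ℂ) + s0 D + v * I) *
              ApolyBar x b₂ (1 - (((alpha D : ℝ) : ℂ) + s0 D + v * I)) *
            omegaW D (((alpha D : ℝ) : ℂ) + s0 D + v * I)‖ :=
        intervalIntegral.integral_nonneg (by linarith) fun v _ => norm_nonneg _
      exact mul_le_mul_of_nonneg_right (mul_le_mul_of_nonneg_right (le_max_left _ _) h114) hint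
    · intro v hv
      exact (hLD hAss _ (hmem v hv)).trans (by gcongr; exact le_max_left _ _)
    · intro v hv
      exact (hAD hAss b₁ b₂ hb₁ hb₂ _ (hmem v hv)).trans (by gcongr; exact le_max_left _ _)
  -- the abstract bookkeeping
  have main := norm_sum_sub_le_of_steps (finsetOf (PsiOne χ))
    (fun x => ∑ ρ ∈ finsetOf (zeroSet D x),
      cstar c' D x ρ * Apoly x a₁ ρ * ApolyBar x a₂ (1 - ρ) * omegaW D ρ)
    (fun x => Lemma81.Itilde x.ψ (Yroot x.ψ) (b1 c' D) (b2 c' D) (b3 c' D) (Nsupp D) (ell2 D)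
      (t0 D) (ell1 D) ((alpha D : ℝ) : ℂ) a₁ a₂)
    (fun x => Lemma81.Itilde x.ψ (Yroot x.ψ) (b1 c' D) (b2 c' D) (b3 c' D) (Nsupp D) (ell2 D)
      (t0 D) (ell1 D) ((-alpha D : ℝ) : ℂ) a₁ a₂)
    (fun x => Lemma81.Itilde x.ψ (Yroot x.ψ) (b1 c' D) (b2 c' D) (b3 c' D) (Nsupp D) (ell2 D)
      (t0 D) (ell1 D) ((alpha D : ℝ) : ℂ) (fun n => conj (a₂ n)) fun n => conj (a₁ n))
    (fun x => Lemma81.segInt (t0 D) (ell1 D) ((alpha D : ℝ) : ℂ) (fun s =>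
      frakcW c' x s * Apoly x a₁ s * ApolyBar x a₂ (1 - s) * omegaW D s))
    (fun x => Lemma81.segInt (t0 D) (ell1 D) ((alpha D : ℝ) : ℂ) (fun s =>
      frakcW c' x s * Apoly x (fun n => conj (a₂ n)) s *
        ApolyBar x (fun n => conj (a₁ n)) (1 - s) * omegaW D s))
    (Theta1 c' χ a₁ a₂) (Theta1 c' χ (fun n => conj (a₂ n)) fun n => conj (a₁ n))
    (e₁ := max C₁ 0 * Real.exp (-c₁ * ell D ^ 10))
    (e₂ := max C₂ 0 * (ell D ^ 114)⁻¹ *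
      ((max C₃ 0 + max C₄ 0) / 2 * (bigP D ^ 2 * ell D ^ 36) * (2 * π * Real.exp (1 / 4))))
    (e₃ := max C₅ 0 * Real.exp (-c₅ * ell D ^ 10))
    (fun x hx => (h81D hAss a₁ a₂ ha₁ ha₂ x (mem_of_mem_finsetOf hx)).trans
      (mul_le_mul_of_nonneg_right (le_max_left _ _) he₁))
    (fun x _ => Lemma81.neg_Itilde_neg_eq_conj x.prim x.p_ne_one (Yroot_spec x.prim).1
      (Yroot_spec x.prim).2 hb1 hb2 hb3 (Nsupp D) (ell2 D) hℓt (alpha D) a₁ a₂)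
    (hI a₁ a₂ ha₁ ha₂) (hI _ _ ha₂c ha₁c)
    ((hshiftD hAss a₁ a₂ ha₁ ha₂).trans (mul_le_mul_of_nonneg_right (le_max_left _ _) he₅))
    ((hshiftD hAss _ _ ha₂c ha₁c).trans (mul_le_mul_of_nonneg_right (le_max_left _ _) he₅))
  refine main.trans ?_
  -- the budget: `#Ψ₁·e₁ ≤ (ε/4)𝔓`, `2e₂ ≤ (ε/2)𝔓`, `2e₃ ≤ (ε/4)𝔓`
  have hcard := card_finsetOf_psiOne_le_frakP χ
  have hP0 : 0 ≤ frakP D := frakP_nonneg D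
  have b1 : ((finsetOf (PsiOne χ)).card : ℝ) * (max C₁ 0 * Real.exp (-c₁ * ell D ^ 10)) ≤
      ε / 4 * frakP D := by
    calc ((finsetOf (PsiOne χ)).card : ℝ) * (max C₁ 0 * Real.exp (-c₁ * ell D ^ 10))
        ≤ frakP D * (ε / 4) := mul_le_mul hcard hD3 (mul_nonneg (le_max_right _ _) he₁) hP0
      _ = ε / 4 * frakP D := mul_comm _ _
  have b2 : 2 * (max C₂ 0 * (ell D ^ 114)⁻¹ *
      ((max C₃ 0 + max C₄ 0) / 2 * (bigP D ^ 2 * ell D ^ 36) * (2 * π * Real.exp (1 / 4)))) ≤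
      ε / 2 * frakP D := by
    have e : 2 * (max C₂ 0 * (ell D ^ 114)⁻¹ *
        ((max C₃ 0 + max C₄ 0) / 2 * (bigP D ^ 2 * ell D ^ 36) * (2 * π * Real.exp (1 / 4)))) =
        2 * K * (bigP D ^ 2 * ell D ^ 36 * (ell D ^ 114)⁻¹) := by rw [hK]; ring
    rw [e]; exact hD2
  have b3 : 2 * (max C₅ 0 * Real.exp (-c₅ * ell D ^ 10)) ≤ ε / 4 * frakP D := by
    have h1 : 2 * (max C₅ 0 * Real.exp (-c₅ * ell D ^ 10)) ≤ ε / 4 := by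
      rw [← mul_assoc]; exact hD4
    have h2 : ε / 4 ≤ ε / 4 * frakP D := by nlinarith
    exact h1.trans h2
  linarith

/-- **The leaf `Ded81 c′` from Lemma 8.1**: the skeleton's deduction node
`Prop22 → Lemma33b → Lemma52 → Lemma59 → Lemma61 → Lemma81` follows from `Lemma81 c′` itself
(its cited inputs Prop. 2.2, Lemmas 3.3 (ii), 5.2, 5.9, 6.1 enter Lemma 8.1's proof only through
the displayed steps consumed by `lemma81_of_steps`). [cite: Zhang2022LandauSiegel, §8 Lemma 8.1] -/
theorem ded81_of_lemma81 {c' : ℝ} (h : Lemma81 c') : Ded81 c' := fun _ _ _ _ _ => h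

end Literature.NumberTheory.LFunctions.Zhang2022.Skeleton
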